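import Literature.Analysis.Complex.LoewnerMatrixCalculus
import HarnessLib

/-!
# Functions of a Hermitian matrix act on (square-)eigenvectors by scalars

For a Hermitian `A ∈ M_ι(ℂ)` and a real function `f`, the functional calculus `f(A)` (`cfc f A`, a polynomial in `A`
interpolating `f` on the spectrum) acts on an eigenvector `Au = Eu` by `f(E)`, and on a vector with `A(Au) = E²u`
(`E ≠ 0`; the situation met for Bogoliubov–de Gennes / Nambu blocks whose SQUARE is scalar on a plane-wave pair) by the
even/odd combination `f(A)u = ½(f(E) + f(−E))·u + (f(E) − f(−E))/(2E)·Au`. These are the evaluation rules by which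
closed-form momentum-space coefficients of quasi-free one-body densities `f_β(H(k))` are identified with entries of
`cfc f_β (H(k))`.

* `aeval_mulVec_of_mulVec_eq_smul'` — `p(A)u = p(E)u` for `Au = Eu` (real polynomial, complex matrix);
* `mem_spectrum_real_of_mulVec_eq_smul` — an eigenvalue with a nonzero eigenvector lies in `spectrum ℝ A`;
* `cfc_mulVec_of_mulVec_eq_smul` — `f(A)u = f(E)u`;
* `cfc_mulVec_of_sq_eigen` — the square-eigenvector rule.

References: Horn–Johnson, *Matrix Analysis* (2nd ed., 2012), Theorem 1.1.6 (`p(A)x = p(λ)x`) [HornJohnson2012];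
Rosenblum–Rovnyak (1985) Ch. 2 Addenda no. 3 (functional calculus of Hermitian matrices by interpolation)
[RosenblumRovnyak1985].
-/

noncomputable section

open Finset Matrix Polynomial

namespace Literature.LinearAlgebra.Matrix

section Eigenvector

variable {ι : Type*} [Fintype ι] [DecidableEq ι]

/-- Powers of `A` on an eigenvector: `Aᵏu = Eᵏu` (real eigenvalue, complex matrix). [cite: HornJohnson2012, Theorem 1.1.6] -/
theorem pow_mulVec_of_mulVec_eq_smul' {A : Matrix ι ι ℂ} {u : ι → ℂ} {E : ℝ} (hu : A *ᵥ u = (E : ℂ) • u) (k : ℕ) :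
    (A ^ k) *ᵥ u = ((E ^ k : ℝ) : ℂ) • u := by
  induction k with
  | zero => simp
  | succ k ih =>
    rw [pow_succ, ← Matrix.mulVec_mulVec, hu, Matrix.mulVec_smul, ih, smul_smul, pow_succ]
    push_cast
    rw [mul_comm]

/-- **`p(A)u = p(E)u`** for a real polynomial `p`, a complex matrix `A` and an eigenvector `Au = Eu`.
[cite: HornJohnson2012, Theorem 1.1.6] -/
theorem aeval_mulVec_of_mulVec_eq_smul' {A : Matrix ι ι ℂ} {u : ι → ℂ} {E : ℝ} (hu : A *ᵥ u = (E : ℂ) • u)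
    (p : ℝ[X]) : (aeval A p) *ᵥ u = ((p.eval E : ℝ) : ℂ) • u := by
  induction p using Polynomial.induction_on' with
  | add p q hp hq => rw [map_add, Matrix.add_mulVec, hp, hq, eval_add]; push_cast; rw [add_smul]
  | monomial k a =>
    rw [aeval_monomial, Algebra.algebraMap_eq_smul_one, smul_mul_assoc, one_mul, Matrix.smul_mulVec,
      pow_mulVec_of_mulVec_eq_smul' hu, ← Complex.coe_smul, smul_smul, eval_monomial]
    push_cast
    ring_nf

/-- An eigenvalue carried by a nonzero eigenvector lies in the real spectrum: `Au = Eu`, `u ≠ 0` ⇒ `E ∈ spectrum ℝ A`.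
[cite: HornJohnson2012, Theorem 1.1.6 and §1.1 (the spectrum is the set of eigenvalues)] -/
theorem mem_spectrum_real_of_mulVec_eq_smul {A : Matrix ι ι ℂ} {u : ι → ℂ} {E : ℝ} (hu : A *ᵥ u = (E : ℂ) • u)
    (hu0 : u ≠ 0) : E ∈ spectrum ℝ A := by
  rw [spectrum.mem_iff, Algebra.algebraMap_eq_smul_one, Matrix.isUnit_iff_isUnit_det, isUnit_iff_ne_zero, Ne,
    not_not, ← Matrix.exists_mulVec_eq_zero_iff]
  refine ⟨u, hu0, ?_⟩
  rw [Matrix.sub_mulVec, Matrix.smul_mulVec, Matrix.one_mulVec, hu, ← Complex.coe_smul, sub_self]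

/-- **`f(A)u = f(E)u`**: the functional calculus of a Hermitian matrix acts on an eigenvector by the value of `f` at
the eigenvalue. [cite: HornJohnson2012, Theorem 1.1.6] [cite: RosenblumRovnyak1985, Ch. 2 Examples and Addenda no. 3] -/
theorem cfc_mulVec_of_mulVec_eq_smul {A : Matrix ι ι ℂ} (hA : A.IsHermitian) (f : ℝ → ℝ) {u : ι → ℂ} {E : ℝ}
    (hu : A *ᵥ u = (E : ℂ) • u) : cfc f A *ᵥ u = ((f E : ℝ) : ℂ) • u := by
  by_cases hu0 : u = 0
  · simp [hu0]
  obtain ⟨q, hq, hqA⟩ := Literature.Analysis.Complex.exists_cfc_eq_aeval hA f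
  rw [hqA, aeval_mulVec_of_mulVec_eq_smul' hu,
    show q.eval E = f E from (hq (mem_spectrum_real_of_mulVec_eq_smul hu hu0)).symm]

/-- **Square-eigenvector rule.** If `A` is Hermitian, `A(Au) = E²u` and `E ≠ 0`, then
`f(A)u = ((f(E) + f(−E))/2)·u + ((f(E) − f(−E))/(2E))·Au` — decompose `u = (Eu + Au)/(2E) + (Eu − Au)/(2E)` into
eigenvectors for `±E`. [cite: HornJohnson2012, Theorem 1.1.6] -/
theorem cfc_mulVec_of_sq_eigen {A : Matrix ι ι ℂ} (hA : A.IsHermitian) (f : ℝ → ℝ) {u : ι → ℂ} {E : ℝ}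
    (hE : E ≠ 0) (hu : A *ᵥ (A *ᵥ u) = ((E ^ 2 : ℝ) : ℂ) • u) :
    cfc f A *ᵥ u = (((f E + f (-E)) / 2 : ℝ) : ℂ) • u + (((f E - f (-E)) / (2 * E) : ℝ) : ℂ) • (A *ᵥ u) := by
  -- the two eigenvectors `u± = E•u ± Au` with eigenvalues `±E`
  have hp : A *ᵥ ((E : ℂ) • u + A *ᵥ u) = (E : ℂ) • ((E : ℂ) • u + A *ᵥ u) := by
    rw [Matrix.mulVec_add, Matrix.mulVec_smul, hu]; push_cast; module
  have hm : A *ᵥ ((E : ℂ) • u - A *ᵥ u) = ((-E : ℝ) : ℂ) • ((E : ℂ) • u - A *ᵥ u) := by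
    rw [Matrix.mulVec_sub, Matrix.mulVec_smul, hu]; push_cast; module
  have h1 := cfc_mulVec_of_mulVec_eq_smul hA f hp
  have h2 := cfc_mulVec_of_mulVec_eq_smul hA f hm
  -- `u = (u₊ + u₋)/(2E)`
  have hE' : (E : ℂ) ≠ 0 := Complex.ofReal_ne_zero.2 hE
  have hdec : u = ((1 / (2 * E) : ℝ) : ℂ) • (((E : ℂ) • u + A *ᵥ u) + ((E : ℂ) • u - A *ᵥ u)) := by
    ext i
    simp only [Pi.smul_apply, Pi.add_apply, Pi.sub_apply, smul_eq_mul]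
    push_cast
    field_simp
    ring
  conv_lhs => rw [hdec, Matrix.mulVec_smul, Matrix.mulVec_add, h1, h2]
  ext i
  simp only [Pi.smul_apply, Pi.add_apply, Pi.sub_apply, smul_eq_mul]
  push_cast
  field_simp
  ring

end Eigenvector

end Literature.LinearAlgebra.Matrix
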